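import Literature.InformationTheory.QuantumCodes.RotatedSurfaceCodeDistance
import Literature.Probability.RandomPlanarGeometry.SAWCount
import HarnessLib

/-!
# The rotated surface code drawn on the diagonal square lattice: `X`-faces as sites of `ℤ²`, qubits as bonds, incidence =
# geometry, and the hand-shaking lemma (an odd column-`0` crossing of a cycle reaches the opposite rough edge)

Topic `Literature/InformationTheory/QuantumCodes` (venture QEC, rung Q5, row 09; qec-type-09 gen 6, item «09.RSCSAW»). All PROVED,
kernel axioms, no named fact. type-08's rotated surface code `RSC(L)` (`RotatedSurfaceCode.lean`: qubits `Fin L × Fin L`,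
`X`-faces `(a', b) ∈ Fin (L+1) × Fin (L-1)`, valid when `a' + b` is odd, `H_X[(a',b), (i,j)] = [valid][a' ∈ {i, i+1}][b ∈ {j-1, j}]`)
has a GRAPHLIKE `X`-sector whose faces sharing a qubit differ by `(±1, ±1)`. Rotating by `45°` — the valid face `(a', b)` goes to
`((a'+b-1)/2, (a'-b-1)/2) ∈ ℤ²` (`rsite`) — the `X`-check graph becomes the square lattice: the qubit `(i, j)` is the horizontal
unit bond `{((i+j)/2 - 1, (i-j)/2), ((i+j)/2, (i-j)/2)}` if `i + j` is even, the vertical one `{((i+j-1)/2, (i-j-1)/2), (·, · + 1)}`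
if odd (`qbond`); `u - v = b` on face sites, so column `j = 0` dangles on the virtual diagonal `u - v = -1` and column `j = L-1`
on `u - v = L-1` (the two rough edges of this sector; DKLP §3.2).

* `HX_apply_eq_ite_of_valid` — **incidence is geometry**: for a valid face `x`, `H_X[x, q] = [rsite x ∈ qbond q]`
  (invalid faces are zero rows, `HX_eq_zero_of_invalid`); `rsite` is injective on valid faces; `qbond` is injective; the two
  ends of a bond are adjacent in `ℤ²`;
* `rscLift Er` — the bond configuration of `ℤ²` opened by a set of qubits; `vbot i` / `vtop i` — the virtual ends of the
  dangling bonds of the qubits `(i, 0)` / `(i, L-1)`;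
* ★ `rsc_exists_reachable_top_of_odd` — **hand-shaking**: for `L ≥ 2`, if `c` is a cycle of the sector (`H_X c = 0`)
  supported in `Er` with an ODD number of qubits in column `0` (`Σ_i c(i, 0) = 1`; every non-trivial logical of the sector
  has this, one encoded qubit), some bottom virtual site `vbot i₀` is joined through bonds of `Er` to some top virtual site
  `vtop i₁` (sum the vanishing syndrome over the valid faces reachable from the bottom edge).

The extraction of a crossing self-avoiding path, its count `≤ L·cₙ` and the DKLP bound are `RotatedSurfaceCodeCrossingPaths.lean`.

## References

* [DennisEtAl2002] E. Dennis, A. Kitaev, A. Landahl, J. Preskill, *Topological quantum memory*, J. Math. Phys. 43 (2002)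
  4452–4505, arXiv:quant-ph/0110143, §3.2 (planar codes: rough edges, relative cycles), §5.3 ("To bound the failure
  probability for a planar code rather than the toric code, we should count the 'relative polygons' that stretch from one
  edge of the lattice to the opposite edge. This change has no effect on the estimate of the threshold.").
* [TomitaSvore2014] PRA 90 (2014) 062320, §2.2 (rotated layout); [BombinMartinDelgado2007Optimal] PRA 76 (2007) 012305, §IV.
-/

namespace Literature.InformationTheory.QuantumCodes

namespace RotatedSurface

open Finset Matrix
open Literature.Probability.LatticeModels (Site zdGraph zdGraph_adj_iff)
open Literature.Probability.Percolation (BondConfig openGraph openGraph_adj)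
open Literature.Probability.RandomPlanarGeometry.SAW.Zd (zdGraph_adj_iff_sub)

variable {L : ℕ}

/-! ### Sites and bonds of the diagonal lattice -/

/-- The site `(u, v)` of `ℤ²`. [folklore] -/
def spt (u v : ℤ) : Site 2 := ![u, v]

/-- Sites are determined by their coordinates. [folklore] -/
private theorem spt_eq_spt_iff {u v u' v' : ℤ} : spt u v = spt u' v' ↔ u = u' ∧ v = v' := by
  refine ⟨fun h => ?_, by rintro ⟨rfl, rfl⟩; rfl⟩
  exact ⟨by simpa [spt] using congrFun h 0, by simpa [spt] using congrFun h 1⟩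

/-- **The site of an `X`-face** `(a', b)`: `((a'+b-1)/2, (a'-b-1)/2)` (exact for the valid faces, `a' + b` odd).
[cite: TomitaSvore2014, §2.2 (the X stabilizers of the rotated layout)] -/
def rsite (x : Fin (L + 1) × Fin (L - 1)) : Site 2 :=
  spt (((x.1.val : ℤ) + x.2.val - 1) / 2) (((x.1.val : ℤ) - x.2.val - 1) / 2)

/-- **The bond of a qubit** `(i, j)`: horizontal `{((i+j)/2 - 1, (i-j)/2), ((i+j)/2, (i-j)/2)}` if `i + j` is even, vertical
`{((i+j-1)/2, (i-j-1)/2), ((i+j-1)/2, (i-j+1)/2)}` if `i + j` is odd — the sites of the two faces of the right colour among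
`{i, i+1} × {j-1, j}` (possibly virtual, `b = -1` or `b = L-1`). [cite: TomitaSvore2014, §2.2 (each data qubit of the rotated layout meets at most two X stabilizers)] -/
def qbond (q : Fin L × Fin L) : Sym2 (Site 2) :=
  if (q.1.val + q.2.val) % 2 = 0 then
    s(spt (((q.1.val : ℤ) + q.2.val) / 2 - 1) (((q.1.val : ℤ) - q.2.val) / 2),
      spt (((q.1.val : ℤ) + q.2.val) / 2) (((q.1.val : ℤ) - q.2.val) / 2))
  else
    s(spt (((q.1.val : ℤ) + q.2.val - 1) / 2) (((q.1.val : ℤ) - q.2.val - 1) / 2),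
      spt (((q.1.val : ℤ) + q.2.val - 1) / 2) (((q.1.val : ℤ) - q.2.val - 1) / 2 + 1))

/-- Advancing a site by a unit vector. [folklore] -/
private theorem spt_add_single (u v : ℤ) :
    spt u v + Pi.single 0 1 = spt (u + 1) v ∧ spt u v + Pi.single 1 1 = spt u (v + 1) := by
  refine ⟨?_, ?_⟩ <;> funext j <;> fin_cases j <;> simp [spt]

/-- **The two ends of the bond of a qubit are adjacent sites of `ℤ²`.** [cite: TomitaSvore2014, §2.2] -/
theorem zdGraph_adj_of_qbond_eq (q : Fin L × Fin L) {P P' : Site 2} (h : qbond q = s(P, P')) :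
    (zdGraph 2).Adj P P' := by
  have key : ∀ (u v : ℤ) (i : Fin 2), (zdGraph 2).Adj (spt u v) (spt u v + Pi.single i 1) := fun u v i => by
    rw [zdGraph_adj_iff_sub]; exact ⟨i, Or.inl (by simp)⟩
  have fin : ∀ {A B : Site 2}, (zdGraph 2).Adj A B → s(A, B) = s(P, P') → (zdGraph 2).Adj P P' := by
    intro A B hAB hs
    rcases Sym2.eq_iff.1 hs with ⟨rfl, rfl⟩ | ⟨rfl, rfl⟩; exacts [hAB, hAB.symm]
  unfold qbond at h
  split_ifs at h with hq
  · have hA := key (((q.1.val : ℤ) + q.2.val) / 2 - 1) (((q.1.val : ℤ) - q.2.val) / 2) 0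
    rw [(spt_add_single _ _).1, sub_add_cancel] at hA
    exact fin hA h
  · have hA := key (((q.1.val : ℤ) + q.2.val - 1) / 2) (((q.1.val : ℤ) - q.2.val - 1) / 2) 1
    rw [(spt_add_single _ _).2] at hA
    exact fin hA h

/-- **The bond map is injective.** [cite: TomitaSvore2014, §2.2 (distinct data qubits)] -/
theorem qbond_injective : Function.Injective (qbond (L := L)) := by
  rintro ⟨i, j⟩ ⟨i', j'⟩ h
  simp only [qbond] at h
  split_ifs at h with h1 h2 h2 <;>
    simp only [Sym2.eq_iff, spt_eq_spt_iff, Prod.mk.injEq, Fin.ext_iff] at h h1 h2 ⊢ <;> omega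

/-- **`rsite` is injective on the valid faces.** [cite: TomitaSvore2014, §2.2] -/
theorem rsite_injOn {x x' : Fin (L + 1) × Fin (L - 1)} (hx : (x.1.val + x.2.val) % 2 = 1)
    (hx' : (x'.1.val + x'.2.val) % 2 = 1) (h : rsite x = rsite x') : x = x' := by
  obtain ⟨a, b⟩ := x
  obtain ⟨a', b'⟩ := x'
  simp only [rsite, spt_eq_spt_iff, Prod.mk.injEq, Fin.ext_iff] at h hx hx' ⊢
  omega

/-- For a valid face, `u - v = b ≥ 0` and `≤ L - 2`: face sites lie strictly between the two virtual diagonals.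
[cite: DennisEtAl2002, §3.2 (the checks between the two rough edges)] -/
theorem rsite_sub_eq {x : Fin (L + 1) × Fin (L - 1)} (hx : (x.1.val + x.2.val) % 2 = 1) :
    rsite x 0 - rsite x 1 = x.2.val := by
  simp only [rsite, spt, Matrix.cons_val_zero, Matrix.cons_val_one]
  omega

/-! ### Incidence is geometry -/

/-- **`H_X[x, q] = [rsite x ∈ qbond q]` for every VALID face `x`**: the face `(a', b)` meets the qubit `(i, j)` iff
`a' ∈ {i, i+1}` and `b ∈ {j-1, j}`, i.e. iff its site is an end of the bond of `(i, j)`.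
[cite: TomitaSvore2014, §2.2 (X stabilizers of the rotated layout)] -/
theorem HX_apply_eq_ite_of_valid {x : Fin (L + 1) × Fin (L - 1)} (hx : (x.1.val + x.2.val) % 2 = 1) (q : Fin L × Fin L) :
    HX L x q = if rsite x ∈ qbond q then 1 else 0 := by
  classical
  obtain ⟨a, b⟩ := x
  obtain ⟨i, j⟩ := q
  have key : rsite (a, b) ∈ qbond (i, j) ↔ (i.val + 1 = a.val ∨ i.val = a.val) ∧ (j.val = b.val ∨ j.val = b.val + 1) := by
    unfold qbond
    simp only at hx ⊢
    split_ifs with hq <;> simp only [rsite, Sym2.mem_iff, spt_eq_spt_iff] <;> omega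
  simp only [HX, vx, rx, cx, key]
  simp only at hx
  rw [if_pos hx, one_mul]
  by_cases h1 : (i.val + 1 = a.val ∨ i.val = a.val) <;> by_cases h2 : (j.val = b.val ∨ j.val = b.val + 1) <;> simp [h1, h2]

/-- **The syndrome at a valid face is the parity of the chain on the bonds at its site.**
[cite: DennisEtAl2002, §3.2 (site defects at the ends of error chains)] -/
theorem HX_mulVec_apply_eq_sum_of_valid {x : Fin (L + 1) × Fin (L - 1)} (hx : (x.1.val + x.2.val) % 2 = 1)
    (c : Fin L × Fin L → ZMod 2) : (HX L *ᵥ c) x = ∑ q, if rsite x ∈ qbond q then c q else 0 := by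
  classical
  simp only [mulVec, dotProduct, HX_apply_eq_ite_of_valid hx]
  exact Finset.sum_congr rfl fun q _ => by split_ifs <;> simp

/-! ### The lift, the virtual ends, and the hand-shaking lemma -/

/-- **The lift** of a set of qubits: the bond configuration of `ℤ²` whose open bonds are their bonds.
[cite: DennisEtAl2002, §3.2 (error chains as links)] -/
def rscLift (Er : Finset (Fin L × Fin L)) : BondConfig (Site 2) := {e | ∃ q ∈ Er, qbond q = e}

/-- A qubit of `Er` opens its bond. [cite: DennisEtAl2002, §3.2] -/
theorem rscLift_adj_of_mem {Er : Finset (Fin L × Fin L)} {q : Fin L × Fin L} (hq : q ∈ Er) {P P' : Site 2}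
    (h : qbond q = s(P, P')) : (openGraph (rscLift Er)).Adj P P' := by
  rw [openGraph_adj]
  exact ⟨⟨q, hq, h⟩, (zdGraph_adj_of_qbond_eq q h).ne⟩

/-- **The virtual (bottom) end of the dangling bond of the qubit `(i, 0)`**, on the diagonal `u - v = -1`.
[cite: DennisEtAl2002, §3.2 (rough edge: links with one end off the lattice)] -/
def vbot (i : Fin L) : Site 2 :=
  if i.val % 2 = 0 then spt ((i.val : ℤ) / 2 - 1) ((i.val : ℤ) / 2) else spt (((i.val : ℤ) - 1) / 2) (((i.val : ℤ) - 1) / 2 + 1)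

/-- **The virtual (top) end of the dangling bond of the qubit `(i, L-1)`**, on the diagonal `u - v = L-1`.
[cite: DennisEtAl2002, §3.2 (the opposite rough edge)] -/
def vtop (i : Fin L) : Site 2 :=
  if (i.val + (L - 1)) % 2 = 0 then spt (((i.val : ℤ) + (L - 1 : ℕ)) / 2) (((i.val : ℤ) - (L - 1 : ℕ)) / 2)
  else spt (((i.val : ℤ) + (L - 1 : ℕ) - 1) / 2) (((i.val : ℤ) - (L - 1 : ℕ) - 1) / 2)

/-- In `ℤ₂`, the indicator of membership in a genuine pair is the sum of the two point indicators. [folklore] -/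
private theorem ite_mem_sym2_eq_add {P A B : Site 2} (hAB : A ≠ B) :
    (if P ∈ s(A, B) then (1 : ZMod 2) else 0) = (if P = A then 1 else 0) + (if P = B then 1 else 0) := by
  classical
  simp only [Sym2.mem_iff]
  by_cases hA : P = A
  · rw [if_pos (Or.inl hA), if_pos hA, if_neg (fun h => hAB (hA.symm.trans h)), add_zero]
  · by_cases hB : P = B
    · rw [if_pos (Or.inr hB), if_neg hA, if_pos hB, zero_add]
    · rw [if_neg (not_or.2 ⟨hA, hB⟩), if_neg hA, if_neg hB, add_zero]

/-- ★ **Hand-shaking: an odd column-`0` crossing reaches the opposite rough edge.** For `L ≥ 2`, let `c` be a cycle of the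
`X`-sector of `RSC(L)` (`H_X c = 0`) supported in `Er` with an odd number of qubits in column `0`. Then some bottom virtual
site `vbot i₀` is joined, through bonds of `Er`, to some top virtual site `vtop i₁`. (Sum the vanishing syndrome over the
valid faces reachable from the bottom edge: a bond between two faces contributes `0` or `2`, a column-`0` bond `1`, a
column-`L-1` bond `0` unless the top edge is reachable.) [cite: DennisEtAl2002, §3.2 and §5.3 (relative polygons stretching from one edge to the opposite edge)] -/
theorem rsc_exists_reachable_top_of_odd (hL : 2 ≤ L) {Er : Finset (Fin L × Fin L)} {c : Fin L × Fin L → ZMod 2}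
    (hc : HX L *ᵥ c = 0) (hcE : ∀ q, c q ≠ 0 → q ∈ Er)
    (hodd : ∑ i : Fin L, c (i, ⟨0, by omega⟩) = 1) :
    ∃ i₀ i₁ : Fin L, (openGraph (rscLift Er)).Reachable (vbot i₀) (vtop i₁) := by
  classical
  by_contra hno
  push Not at hno
  set G := openGraph (rscLift Er) with hG
  set R : Site 2 → Prop := fun P => ∃ i₀ : Fin L, G.Reachable (vbot i₀) P with hR
  have hRadj : ∀ {P P' : Site 2}, G.Adj P P' → (R P ↔ R P') := fun h =>
    ⟨fun ⟨i₀, hr⟩ => ⟨i₀, hr.trans h.reachable⟩, fun ⟨i₀, hr⟩ => ⟨i₀, hr.trans h.symm.reachable⟩⟩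
  set V : Fin (L + 1) × Fin (L - 1) → Prop := fun x => (x.1.val + x.2.val) % 2 = 1 with hV
  set χ : Fin (L + 1) × Fin (L - 1) → ZMod 2 := fun x => if V x ∧ R (rsite x) then 1 else 0 with hχ
  set f : Site 2 → ZMod 2 := fun P => ∑ x, if V x ∧ rsite x = P then χ x else 0 with hf
  have hf_site : ∀ x₀, V x₀ → f (rsite x₀) = χ x₀ := fun x₀ hx₀ => by
    simp only [hf]
    rw [Finset.sum_eq_single x₀, if_pos ⟨hx₀, rfl⟩]
    · exact fun x _ hx => if_neg fun h => hx (rsite_injOn h.1 hx₀ h.2)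
    · intro h; exact absurd (Finset.mem_univ _) h
  have hf_virtual : ∀ P : Site 2, (∀ x : Fin (L + 1) × Fin (L - 1), V x → rsite x ≠ P) → f P = 0 := fun P hP => by
    simp only [hf]
    exact Finset.sum_eq_zero fun x _ => if_neg fun h => hP x h.1 h.2
  -- `g q = Σ_x χ(x) H_X(x, q) = f(P₁) + f(P₂)` for the bond `{P₁, P₂}` of `q`
  have hg : ∀ (q : Fin L × Fin L) {P₁ P₂ : Site 2}, qbond q = s(P₁, P₂) →
      ∑ x, χ x * HX L x q = f P₁ + f P₂ := by
    intro q P₁ P₂ hq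
    have hne : P₁ ≠ P₂ := (zdGraph_adj_of_qbond_eq q hq).ne
    simp only [hf, ← Finset.sum_add_distrib]
    refine Finset.sum_congr rfl fun x _ => ?_
    by_cases hx : V x
    · rw [HX_apply_eq_ite_of_valid hx, hq, ite_mem_sym2_eq_add hne]
      by_cases h1 : rsite x = P₁
      · have h2 : rsite x ≠ P₂ := fun h => hne (h1.symm.trans h)
        rw [if_pos h1, if_neg h2, if_pos ⟨hx, h1⟩, if_neg (fun h => h2 h.2)]; ring
      · by_cases h2 : rsite x = P₂
        · rw [if_neg h1, if_pos h2, if_neg (fun h => h1 h.2), if_pos ⟨hx, h2⟩]; ring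
        · rw [if_neg h1, if_neg h2, if_neg (fun h => h1 h.2), if_neg (fun h => h2 h.2)]; ring
    · have h0 : HX L x q = 0 := by rw [HX_eq_zero_of_invalid x hx]; rfl
      rw [h0, mul_zero, if_neg (fun h => hx h.1), if_neg (fun h => hx h.1), add_zero]
  -- the column-`0` indicator
  set bot : Fin L × Fin L → ZMod 2 := fun q => if q.2.val = 0 then 1 else 0 with hbot
  -- evaluation of `g` on the open bonds
  have hval : ∀ q ∈ Er, ∑ x, χ x * HX L x q = bot q := by
    rintro ⟨i, j⟩ hq
    simp only [hbot]
    -- the bond and its two ends, by the parity of `i + j` and the column `j`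
    by_cases hpar : (i.val + j.val) % 2 = 0
    · -- horizontal bond between the faces `(i, j-1)` and `(i+1, j)`
      have hB : qbond (i, j) = s(spt (((i.val : ℤ) + j.val) / 2 - 1) (((i.val : ℤ) - j.val) / 2),
          spt (((i.val : ℤ) + j.val) / 2) (((i.val : ℤ) - j.val) / 2)) := by
        unfold qbond; rw [if_pos hpar]
      rw [hg _ hB]
      have hadj := rscLift_adj_of_mem hq hB
      by_cases hj0 : j.val = 0
      · -- column `0`: the left end is `vbot i` (virtual), the right end is the valid face `(i+1, 0)`
        rw [if_pos hj0]
        have hi : i.val % 2 = 0 := by omega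
        have h1 : f (spt (((i.val : ℤ) + j.val) / 2 - 1) (((i.val : ℤ) - j.val) / 2)) = 0 := by
          refine hf_virtual _ fun x hx hxe => ?_
          obtain ⟨a, b⟩ := x
          simp only [rsite, spt_eq_spt_iff, hV] at hxe hx
          omega
        have hxv : V (⟨i.val + 1, by omega⟩, ⟨0, by omega⟩) := by simp only [hV]; omega
        have hx2 : rsite ((⟨i.val + 1, by omega⟩, ⟨0, by omega⟩) : Fin (L + 1) × Fin (L - 1)) =
            spt (((i.val : ℤ) + j.val) / 2) (((i.val : ℤ) - j.val) / 2) := by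
          unfold rsite; rw [spt_eq_spt_iff]; dsimp only; omega
        have h2 : f (spt (((i.val : ℤ) + j.val) / 2) (((i.val : ℤ) - j.val) / 2)) = 1 := by
          rw [← hx2, hf_site _ hxv, hχ]
          simp only
          rw [if_pos]
          refine ⟨hxv, (hRadj (hx2 ▸ hadj)).1 ⟨i, ?_⟩⟩
          have hvb : vbot i = spt (((i.val : ℤ) + j.val) / 2 - 1) (((i.val : ℤ) - j.val) / 2) := by
            unfold vbot; rw [if_pos hi, spt_eq_spt_iff]; omega
          rw [hvb]
        rw [h1, h2, zero_add]
      · rw [if_neg hj0]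
        by_cases hjL : j.val = L - 1
        · -- column `L-1`: the left end is the valid face `(i, L-2)`, the right end is `vtop i` (virtual)
          have h2 : f (spt (((i.val : ℤ) + j.val) / 2) (((i.val : ℤ) - j.val) / 2)) = 0 := by
            refine hf_virtual _ fun x hx hxe => ?_
            obtain ⟨a, b⟩ := x
            have hb := b.2
            simp only [rsite, spt_eq_spt_iff, hV] at hxe hx
            omega
          have hxv : V (⟨i.val, by omega⟩, ⟨j.val - 1, by omega⟩) := by simp only [hV]; omega
          have hx1 : rsite ((⟨i.val, by omega⟩, ⟨j.val - 1, by omega⟩) : Fin (L + 1) × Fin (L - 1)) =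
              spt (((i.val : ℤ) + j.val) / 2 - 1) (((i.val : ℤ) - j.val) / 2) := by
            unfold rsite; rw [spt_eq_spt_iff]; dsimp only; omega
          have h1 : f (spt (((i.val : ℤ) + j.val) / 2 - 1) (((i.val : ℤ) - j.val) / 2)) = 0 := by
            rw [← hx1, hf_site _ hxv, hχ]
            simp only
            rw [if_neg]
            rintro ⟨-, i₀, hr⟩
            refine hno i₀ i ?_
            have hvt : vtop i = spt (((i.val : ℤ) + j.val) / 2) (((i.val : ℤ) - j.val) / 2) := by
              unfold vtop
              rw [if_pos (by omega), spt_eq_spt_iff]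
              omega
            rw [hvt]
            exact (hx1 ▸ hr).trans hadj.reachable
          rw [h1, h2, add_zero]
        · -- interior: both ends are valid faces `(i, j-1)` and `(i+1, j)`
          have hxv1 : V (⟨i.val, by omega⟩, ⟨j.val - 1, by omega⟩) := by simp only [hV]; omega
          have hxv2 : V (⟨i.val + 1, by omega⟩, ⟨j.val, by omega⟩) := by simp only [hV]; omega
          have hx1 : rsite ((⟨i.val, by omega⟩, ⟨j.val - 1, by omega⟩) : Fin (L + 1) × Fin (L - 1)) =
              spt (((i.val : ℤ) + j.val) / 2 - 1) (((i.val : ℤ) - j.val) / 2) := by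
            unfold rsite; rw [spt_eq_spt_iff]; dsimp only; omega
          have hx2 : rsite ((⟨i.val + 1, by omega⟩, ⟨j.val, by omega⟩) : Fin (L + 1) × Fin (L - 1)) =
              spt (((i.val : ℤ) + j.val) / 2) (((i.val : ℤ) - j.val) / 2) := by
            unfold rsite; rw [spt_eq_spt_iff]; dsimp only; omega
          rw [← hx1, ← hx2, hf_site _ hxv1, hf_site _ hxv2, hχ]
          simp only
          have hiff := hRadj (hx1 ▸ hx2 ▸ hadj)
          by_cases hr : R (rsite ((⟨i.val, by omega⟩, ⟨j.val - 1, by omega⟩) : Fin (L + 1) × Fin (L - 1)))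
          · rw [if_pos ⟨hxv1, hr⟩, if_pos ⟨hxv2, hiff.1 hr⟩]; decide
          · rw [if_neg (fun h => hr h.2), if_neg (fun h => hr (hiff.2 h.2)), add_zero]
    · -- vertical bond between the faces `(i, j)` and `(i+1, j-1)`
      have hB : qbond (i, j) = s(spt (((i.val : ℤ) + j.val - 1) / 2) (((i.val : ℤ) - j.val - 1) / 2),
          spt (((i.val : ℤ) + j.val - 1) / 2) (((i.val : ℤ) - j.val - 1) / 2 + 1)) := by
        unfold qbond; rw [if_neg hpar]
      rw [hg _ hB]
      have hadj := rscLift_adj_of_mem hq hB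
      by_cases hj0 : j.val = 0
      · -- column `0`: the lower end is the valid face `(i, 0)`, the upper end `vbot i` (virtual)
        rw [if_pos hj0]
        have hi : i.val % 2 = 1 := by omega
        have h2 : f (spt (((i.val : ℤ) + j.val - 1) / 2) (((i.val : ℤ) - j.val - 1) / 2 + 1)) = 0 := by
          refine hf_virtual _ fun x hx hxe => ?_
          obtain ⟨a, b⟩ := x
          simp only [rsite, spt_eq_spt_iff, hV] at hxe hx
          omega
        have hxv : V (⟨i.val, by omega⟩, ⟨0, by omega⟩) := by simp only [hV]; omega
        have hx1 : rsite ((⟨i.val, by omega⟩, ⟨0, by omega⟩) : Fin (L + 1) × Fin (L - 1)) =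
            spt (((i.val : ℤ) + j.val - 1) / 2) (((i.val : ℤ) - j.val - 1) / 2) := by
          unfold rsite; rw [spt_eq_spt_iff]; dsimp only; omega
        have h1 : f (spt (((i.val : ℤ) + j.val - 1) / 2) (((i.val : ℤ) - j.val - 1) / 2)) = 1 := by
          rw [← hx1, hf_site _ hxv, hχ]
          simp only
          rw [if_pos]
          refine ⟨hxv, (hRadj (hx1 ▸ hadj)).2 ⟨i, ?_⟩⟩
          have hvb : vbot i = spt (((i.val : ℤ) + j.val - 1) / 2) (((i.val : ℤ) - j.val - 1) / 2 + 1) := by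
            unfold vbot; rw [if_neg (by omega), spt_eq_spt_iff]; omega
          rw [hvb]
        rw [h1, h2, add_zero]
      · rw [if_neg hj0]
        by_cases hjL : j.val = L - 1
        · -- column `L-1`: `(i, L-1)` is virtual (`vtop i`), `(i+1, L-2)` is a valid face
          have h1 : f (spt (((i.val : ℤ) + j.val - 1) / 2) (((i.val : ℤ) - j.val - 1) / 2)) = 0 := by
            refine hf_virtual _ fun x hx hxe => ?_
            obtain ⟨a, b⟩ := x
            have hb := b.2
            simp only [rsite, spt_eq_spt_iff, hV] at hxe hx
            omega
          have hxv : V (⟨i.val + 1, by omega⟩, ⟨j.val - 1, by omega⟩) := by simp only [hV]; omega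
          have hx2 : rsite ((⟨i.val + 1, by omega⟩, ⟨j.val - 1, by omega⟩) : Fin (L + 1) × Fin (L - 1)) =
              spt (((i.val : ℤ) + j.val - 1) / 2) (((i.val : ℤ) - j.val - 1) / 2 + 1) := by
            unfold rsite; rw [spt_eq_spt_iff]; dsimp only; omega
          have h2 : f (spt (((i.val : ℤ) + j.val - 1) / 2) (((i.val : ℤ) - j.val - 1) / 2 + 1)) = 0 := by
            rw [← hx2, hf_site _ hxv, hχ]
            simp only
            rw [if_neg]
            rintro ⟨-, i₀, hr⟩
            refine hno i₀ i ?_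
            have hvt : vtop i = spt (((i.val : ℤ) + j.val - 1) / 2) (((i.val : ℤ) - j.val - 1) / 2) := by
              unfold vtop
              rw [if_neg (by omega), spt_eq_spt_iff]
              omega
            rw [hvt]
            exact (hx2 ▸ hr).trans hadj.symm.reachable
          rw [h1, h2, add_zero]
        · -- interior: both ends are valid faces `(i, j)` and `(i+1, j-1)`
          have hxv1 : V (⟨i.val, by omega⟩, ⟨j.val, by omega⟩) := by simp only [hV]; omega
          have hxv2 : V (⟨i.val + 1, by omega⟩, ⟨j.val - 1, by omega⟩) := by simp only [hV]; omega
          have hx1 : rsite ((⟨i.val, by omega⟩, ⟨j.val, by omega⟩) : Fin (L + 1) × Fin (L - 1)) =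
              spt (((i.val : ℤ) + j.val - 1) / 2) (((i.val : ℤ) - j.val - 1) / 2) := by
            unfold rsite; rw [spt_eq_spt_iff]; dsimp only; omega
          have hx2 : rsite ((⟨i.val + 1, by omega⟩, ⟨j.val - 1, by omega⟩) : Fin (L + 1) × Fin (L - 1)) =
              spt (((i.val : ℤ) + j.val - 1) / 2) (((i.val : ℤ) - j.val - 1) / 2 + 1) := by
            unfold rsite; rw [spt_eq_spt_iff]; dsimp only; omega
          rw [← hx1, ← hx2, hf_site _ hxv1, hf_site _ hxv2, hχ]
          simp only
          have hiff := hRadj (hx1 ▸ hx2 ▸ hadj)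
          by_cases hr : R (rsite ((⟨i.val, by omega⟩, ⟨j.val, by omega⟩) : Fin (L + 1) × Fin (L - 1)))
          · rw [if_pos ⟨hxv1, hr⟩, if_pos ⟨hxv2, hiff.1 hr⟩]; decide
          · rw [if_neg (fun h => hr h.2), if_neg (fun h => hr (hiff.2 h.2)), add_zero]
  -- (1) the total syndrome over the reachable valid faces vanishes; (2) swap the sums
  have h1 : ∑ x, χ x * (HX L *ᵥ c) x = 0 := Finset.sum_eq_zero fun x _ => by rw [hc, Pi.zero_apply, mul_zero]
  have h2 : ∑ x, χ x * (HX L *ᵥ c) x = ∑ q, c q * ∑ x, χ x * HX L x q := by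
    simp only [mulVec, dotProduct, Finset.mul_sum]
    exact Finset.sum_comm.trans (Finset.sum_congr rfl fun q _ => Finset.sum_congr rfl fun x _ => by ring)
  -- (3) only the column-`0` bonds survive
  have h3 : ∑ q, c q * ∑ x, χ x * HX L x q = ∑ q, c q * bot q := by
    refine Finset.sum_congr rfl fun q _ => ?_
    by_cases hc0 : c q = 0
    · rw [hc0, zero_mul, zero_mul]
    · rw [hval q (hcE q hc0)]
  -- (4) and they add up to the column-`0` crossing number
  have h4 : ∑ q, c q * bot q = ∑ i : Fin L, c (i, ⟨0, by omega⟩) := by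
    simp only [hbot, Fintype.sum_prod_type, mul_ite, mul_one, mul_zero]
    refine Finset.sum_congr rfl fun i _ => ?_
    rw [Finset.sum_eq_single (⟨0, by omega⟩ : Fin L)]
    · simp
    · intro j _ hj
      rw [if_neg]
      exact fun h => hj (Fin.ext h)
    · intro h; exact absurd (Finset.mem_univ _) h
  rw [h2, h3, h4, hodd] at h1
  exact one_ne_zero h1

end RotatedSurface

end Literature.InformationTheory.QuantumCodes
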